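import Mathlib
import Summits.FinalStateConjecture.FinalStateConjecture.Theorems.StarvedNecksNecksCertifyStubSeamSurgeryHelpers

/-!
# Route StarvedNecks — crux `NecksCertify`, line `bargmann-small-late-exterior`: rung SCR

Stub `stub_seamClockRadii` (statement `SeamClockRadii` of the line skeleton, verbatim): the purely
NUMERIC clauses of the seam after re-clocking the hole charts.  For finitely many orthochronous
motions `(Λⱼ, cⱼ)` with hole clocks / radii `tⱼ, rⱼ` of the boosted Kerr backgrounds, continuous
flat-tube profiles `ρ'ⱼ ≥ R₁ + 1` and monotone continuous sublinear certified radii `Rgⱼ ≥ R₁ + 4`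
(margin-3 swallowing A5, margin-2 disjointness A10), we produce clock shifts `sⱼ ≥ 0` and the late
flat time `τ₀' := τ₁` with the eight clauses S1, raw clock lag, S8, S9, S12 and the converse
comparison.

The only analysis is one-dimensional:

* `exists_sqrt_mul_le`: sublinearity `Rg s / s → 0` in the usable form
  `√(γ² − 1)·Rg τ ≤ (γ − 1)·τ` for `τ ≥ T₀` (`γ ≥ 1`; the case `γ = 1` is trivial since then
  `√(γ² − 1) = 0`);
* `exists_clockShift`: hence `τ ↦ c⁰ + (γ − 1)τ − √(γ² − 1)(Rg τ + 2 + A)` is bounded below on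
  `[τ₁, ∞)` (monotonicity of `Rg` on `[τ₁, T₀]`), packaged as a shift `s ≥ 0` with
  `τ − s ≤ c⁰ + γτ − √(γ² − 1)(Rg τ + 2 + A)`;
* `flatTime_mem_Icc`: the landed Lorentz clock algebra
  (`Seam.abs_flatTime_sub_le`: `|y⁰ − c⁰ − γ·t(y)| ≤ √(γ² − 1)(r(y) + |a|)`, `γ = (Λ∂₀)⁰`)
  rewritten in the clock variables `t, r` of one hole.

The converse comparison uses the monotone majorant `c⁰ + γ t + √(γ² − 1)(Rg t + 2 + |a|)` of the
flat time on the certified tube and a bound over the finitely many holes (`Finite.exists_le`).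

Mathlib + the landed helper module `StarvedNecksNecksCertifyStubSeamSurgeryHelpers`; no definitions,
no named facts.
-/

noncomputable section

open scoped Manifold ContDiff Topology ENNReal
open Filter Set MeasureTheory Topology Literature.Geometry.Lorentzian

namespace Summit.FinalStateConjecture.FinalStateConjecture.Theorems.NecksCertifyBargmann.ClockRadii

open Summit.FinalStateConjecture.FinalStateConjecture.Theorems.NecksCertifyBargmann.Seam

/-- **Sublinearity in usable form.**  If `γ ≥ 1` and `Rg s / s → 0` as `s → ∞`, then
`√(γ² − 1)·Rg τ ≤ (γ − 1)·τ` for all `τ` beyond some `T₀` (for `γ = 1` both sides vanish /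
are `0`; for `γ > 1` take `ε := γ − 1` in the limit of `√(γ² − 1)·Rg s / s → 0`). -/
theorem exists_sqrt_mul_le (γ : ℝ) (Rg : ℝ → ℝ) (hγ : 1 ≤ γ)
    (hsub : Tendsto (fun s ↦ Rg s / s) atTop (𝓝 0)) :
    ∃ T₀ : ℝ, ∀ τ, T₀ ≤ τ → Real.sqrt (γ ^ 2 - 1) * Rg τ ≤ (γ - 1) * τ := by
  rcases hγ.eq_or_lt with h | h
  · subst h
    exact ⟨0, fun τ _ ↦ by simp⟩
  · have hlim := hsub.const_mul (Real.sqrt (γ ^ 2 - 1))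
    rw [mul_zero] at hlim
    obtain ⟨T, hT⟩ :=
      Filter.eventually_atTop.1 (Metric.tendsto_nhds.1 hlim (γ - 1) (by linarith))
    refine ⟨max T 1, fun τ hτ ↦ ?_⟩
    have hτ0 : 0 < τ := lt_of_lt_of_le one_pos ((le_max_right T 1).trans hτ)
    have h1 := hT τ ((le_max_left T 1).trans hτ)
    rw [Real.dist_eq, sub_zero, ← mul_div_assoc, abs_lt, div_lt_iff₀ hτ0] at h1
    exact h1.2.le

/-- **Clock shift of one hole.**  For `γ ≥ 1` and a monotone sublinear `Rg`, the function
`τ ↦ c0 + (γ − 1)τ − √(γ² − 1)(Rg τ + 2 + A)` is bounded below on `[τ₁, ∞)`: beyond `T₀`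
(`exists_sqrt_mul_le`) the linear term wins, on `[τ₁, T₀]` monotonicity of `Rg` bounds the
negative term by its value at `T₀`.  Packaged as a shift `s ≥ 0` with
`τ − s ≤ c0 + γτ − √(γ² − 1)(Rg τ + 2 + A)` for `τ ≥ τ₁`. -/
theorem exists_clockShift (c0 γ A τ₁ : ℝ) (Rg : ℝ → ℝ) (hγ : 1 ≤ γ) (hmono : Monotone Rg)
    (hsub : Tendsto (fun s ↦ Rg s / s) atTop (𝓝 0)) :
    ∃ s : ℝ, 0 ≤ s ∧
      ∀ τ, τ₁ ≤ τ → τ - s ≤ c0 + γ * τ - Real.sqrt (γ ^ 2 - 1) * (Rg τ + 2 + A) := by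
  obtain ⟨T₀, hkey⟩ := exists_sqrt_mul_le γ Rg hγ hsub
  have hσ0 : 0 ≤ Real.sqrt (γ ^ 2 - 1) := Real.sqrt_nonneg _
  have hγ0 : 0 ≤ γ - 1 := by linarith
  refine ⟨max 0 (Real.sqrt (γ ^ 2 - 1) * (2 + A) + (γ - 1) * |T₀ - τ₁| - c0), le_max_left _ _,
    fun τ hτ ↦ ?_⟩
  have hs := le_max_right 0 (Real.sqrt (γ ^ 2 - 1) * (2 + A) + (γ - 1) * |T₀ - τ₁| - c0)
  have habs := mul_le_mul_of_nonneg_left (le_abs_self (T₀ - τ₁)) hγ0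
  have hnn := mul_nonneg hγ0 (abs_nonneg (T₀ - τ₁))
  rcases le_total T₀ τ with h | h
  · have h1 := hkey τ h
    linarith
  · have h1 := hkey T₀ le_rfl
    have h2 := mul_le_mul_of_nonneg_left (hmono h) hσ0
    have h3 := mul_le_mul_of_nonneg_left hτ hγ0
    linarith

/-- **Flat time versus hole time, clock variables.**  On the boosted Kerr background of a motion
`(Λ, c)` with spin `a`, writing `γ = (Λ∂₀)⁰` and `t, r` for its time / radius functions,
`c⁰ + γ t(y) − √(γ² − 1)(r(y) + |a|) ≤ y⁰ ≤ c⁰ + γ t(y) + √(γ² − 1)(r(y) + |a|)`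
(the landed comparison `Seam.abs_flatTime_sub_le`, unfolded with `abs_le`). -/
theorem flatTime_mem_Icc {Λ : lorentzGroup} {c : E4} {M a γ : ℝ} {t r : E4 → ℝ}
    (ht : ∀ y, t y = (boostedKerrBackground Λ c M a).time y)
    (hr : ∀ y, r y = (boostedKerrBackground Λ c M a).radius y)
    (hγ : γ = ((Λ : E4 ≃L[ℝ] E4) (E4.basisVector 0)) 0) (y : E4) :
    c 0 + γ * t y - Real.sqrt (γ ^ 2 - 1) * (r y + |a|) ≤ y 0 ∧
      y 0 ≤ c 0 + γ * t y + Real.sqrt (γ ^ 2 - 1) * (r y + |a|) := by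
  have h := abs_flatTime_sub_le Λ c M a y
  rw [← ht, ← hr, ← hγ, abs_le] at h
  constructor <;> linarith [h.1, h.2]

/-- Registered stub SCR of the line `bargmann-small-late-exterior` (statement = `SeamClockRadii` of
the skeleton, verbatim): the **re-clocked certified radii**.  Given finitely many orthochronous
motions with hole clocks / radii `tⱼ, rⱼ`, continuous tube profiles `ρ'ⱼ ≥ R₁ + 1`, monotone
continuous sublinear certified radii `Rgⱼ ≥ R₁ + 4` with the margin-3 swallowing (A5) and the
margin-2 disjointness (A10) at flat-late times, there are shifts `sⱼ ≥ 0` (`exists_clockShift`) and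
`τ₀' := τ₁` such that: S1 (monotone, continuous, `≥ R₁ + 4`, `ρ' ≥ R₁`); the raw clock lag
(hole-late on the certified tube `+2` ⇒ `tⱼ − sⱼ ≤ y⁰`, from `flatTime_mem_Icc`); S8 (margin 2,
from A5); S9; S12 in both time cases (from A10, the second case through the clock lag); and the
converse comparison (flat-late on a certified tube ⇒ re-clocked hole time as late as required, by
monotonicity of `t ↦ c⁰ + γt + √(γ² − 1)(Rg t + 2 + |a|)` and `Finite.exists_le` over the holes). -/
theorem stub_seamClockRadii :
  ∀ (N : ℕ) (Λ : Fin N → lorentzGroup) (c : Fin N → E4) (M a : Fin N → ℝ) (R₁ τ₁ : ℝ)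
    (ρ' Rg : Fin N → ℝ → ℝ) (t r : Fin N → E4 → ℝ),
    (∀ j y, t j y = (boostedKerrBackground (Λ j) (c j) (M j) (a j)).time y) →
    (∀ j y, r j y = (boostedKerrBackground (Λ j) (c j) (M j) (a j)).radius y) →
    (∀ j, 0 < ((Λ j : E4 ≃L[ℝ] E4) (E4.basisVector 0)) 0) →
    (∀ i, Continuous (ρ' i) ∧ ∀ s, R₁ + 1 ≤ ρ' i s) →
    (∀ i, Monotone (Rg i) ∧ Continuous (Rg i) ∧ Tendsto (fun s ↦ Rg i s / s) atTop (𝓝 0) ∧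
      ∀ s, R₁ + 4 ≤ Rg i s) →
    (∀ j (y : E4), τ₁ ≤ y 0 → r j y ≤ ρ' j (y 0) → r j y + 3 ≤ Rg j (t j y)) →
    (∀ j j' (y : E4), j ≠ j' → τ₁ ≤ y 0 → r j y ≤ Rg j (t j y) + 2 → Rg j' (t j' y) + 2 < r j' y) →
    ∃ (s : Fin N → ℝ) (τ₀' : ℝ), τ₁ ≤ τ₀' ∧ (∀ i, 0 ≤ s i) ∧
      (∀ i, Monotone (fun τ ↦ Rg i (τ + s i)) ∧ Continuous (fun τ ↦ Rg i (τ + s i)) ∧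
        ∀ τ, R₁ + 4 ≤ Rg i (τ + s i) ∧ R₁ ≤ ρ' i τ) ∧
      (∀ j (y : E4), τ₁ ≤ t j y → r j y ≤ Rg j (t j y) + 2 → t j y - s j ≤ y 0) ∧
      (∀ j (y : E4), τ₀' ≤ y 0 → r j y ≤ ρ' j (y 0) → r j y + 2 ≤ Rg j (t j y - s j + s j)) ∧
      (∀ j (y : E4), τ₀' ≤ t j y - s j → r j y ≤ Rg j (t j y - s j + s j) + 2 → t j y - s j ≤ y 0) ∧
      (∀ j j' (y : E4), j ≠ j' → (τ₀' ≤ y 0 ∨ τ₀' ≤ t j y - s j) →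
        r j y ≤ Rg j (t j y - s j + s j) + 1 → Rg j' (t j' y - s j' + s j') + 1 < r j' y) ∧
      (∀ T : ℝ, ∃ Y : ℝ, ∀ j (y : E4), Y ≤ y 0 → r j y ≤ Rg j (t j y) + 2 → T ≤ t j y - s j) := by
  intro N Λ c M a R₁ τ₁ ρ' Rg t r ht hr hΛ hρ' hRg hA5 hA10
  -- the Lorentz factors `γ j = (Λ j ∂₀)⁰ ≥ 1` of the holes
  obtain ⟨γ, hγ⟩ : ∃ γ : Fin N → ℝ, ∀ j, γ j = ((Λ j : E4 ≃L[ℝ] E4) (E4.basisVector 0)) 0 :=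
    ⟨_, fun j ↦ rfl⟩
  have hγ1 : ∀ j, 1 ≤ γ j := fun j ↦ by
    rw [hγ j]
    exact one_le_lorentz_time (Λ j) (hΛ j)
  have hσ : ∀ j, 0 ≤ Real.sqrt (γ j ^ 2 - 1) := fun j ↦ Real.sqrt_nonneg _
  -- the two-sided flat-time / hole-time comparison, hole by hole
  have hcmp : ∀ j (y : E4),
      c j 0 + γ j * t j y - Real.sqrt (γ j ^ 2 - 1) * (r j y + |a j|) ≤ y 0 ∧
        y 0 ≤ c j 0 + γ j * t j y + Real.sqrt (γ j ^ 2 - 1) * (r j y + |a j|) :=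
    fun j y ↦ flatTime_mem_Icc (ht j) (hr j) (hγ j) y
  -- the clock shifts
  choose s hs0 hs using fun j ↦
    exists_clockShift (c j 0) (γ j) |a j| τ₁ (Rg j) (hγ1 j) (hRg j).1 (hRg j).2.2.1
  -- raw clock lag: hole-late on the certified tube `+2` ⇒ re-clocked hole time ≤ flat time
  have hC4 : ∀ j (y : E4), τ₁ ≤ t j y → r j y ≤ Rg j (t j y) + 2 → t j y - s j ≤ y 0 := by
    intro j y h1 h2
    have h3 := mul_le_mul_of_nonneg_left
      (show r j y + |a j| ≤ Rg j (t j y) + 2 + |a j| by linarith) (hσ j)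
    linarith [(hcmp j y).1, hs j (t j y) h1]
  refine ⟨s, τ₁, le_rfl, hs0, fun i ↦ ⟨fun u v huv ↦ (hRg i).1 (by
      show u + s i ≤ v + s i
      linarith),
    (hRg i).2.1.comp (continuous_id.add continuous_const),
    fun τ ↦ ⟨(hRg i).2.2.2 _, by linarith [(hρ' i).2 τ]⟩⟩, hC4, ?_, ?_, ?_, ?_⟩
  · -- S8: margin 2 from the margin-3 swallowing A5
    intro j y h1 h2
    rw [sub_add_cancel]
    linarith [hA5 j y h1 h2]
  · -- S9: the clock lag at re-clocked-hole-late times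
    intro j y h1 h2
    rw [sub_add_cancel] at h2
    exact hC4 j y (by linarith [hs0 j]) h2
  · -- S12: disjointness with margin 1 in both time cases, from A10
    intro j j' y hjj' hcase h1
    rw [sub_add_cancel] at h1 ⊢
    have hy : τ₁ ≤ y 0 := by
      rcases hcase with h | h
      · exact h
      · linarith [hC4 j y (by linarith [hs0 j]) (by linarith), hs0 j]
    linarith [hA10 j j' y hjj' hy (by linarith)]
  · -- converse comparison: flat-late on a certified tube ⇒ re-clocked hole time ≥ T
    intro T
    obtain ⟨B, hB⟩ := Finite.exists_le fun j : Fin N ↦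
      c j 0 + γ j * (T + s j) + Real.sqrt (γ j ^ 2 - 1) * (Rg j (T + s j) + 2 + |a j|)
    refine ⟨B + 1, fun j y hY h2 ↦ ?_⟩
    by_contra hlt
    have hle : t j y ≤ T + s j := by linarith [not_le.1 hlt]
    have hBj : c j 0 + γ j * (T + s j) +
        Real.sqrt (γ j ^ 2 - 1) * (Rg j (T + s j) + 2 + |a j|) ≤ B := hB j
    have hm1 := mul_le_mul_of_nonneg_left
      (show r j y + |a j| ≤ Rg j (T + s j) + 2 + |a j| by linarith [(hRg j).1 hle]) (hσ j)
    have hm2 := mul_le_mul_of_nonneg_left hle (show 0 ≤ γ j by linarith [hγ1 j])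
    linarith [(hcmp j y).2]

end Summit.FinalStateConjecture.FinalStateConjecture.Theorems.NecksCertifyBargmann.ClockRadii

end
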